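import Summits.MatrixMultiplication.OmegaCensus.SmallFormats.MatMul22nRankGF7Slack5Search
import HarnessLib

/-!
# ω-census family (a): replay of the slack-5 search certificate, CHECK A part 10 of 12 (elements `252 ≤ h < 280`)

Cell `pub-omega` (unit `pub-omega-tensor-g16`), topic `Summits/MatrixMultiplication/OmegaCensus` (sub-folder `SmallFormats`).
Framing (verbatim): lottery ticket; floor = certified bounds/negative ranges. HONEST FRAMING: machine-generated kernel replay
(`pub-omega-tensor-g16/code/gen5_runs.py`): `levelsOK5n h = true` for the elements `252 ≤ h < 280` of `PGL₂(7)`: for every slot `(c, h)`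
(`c < 656`) and bucket level, if the key of its column is visited then the bucket holds an entry with that column (SIMD key planes,
`MatMul22nRankGF7Plane`). Meaning: `slotOK5_of_levelsOK5` (`MatMul22nRankGF7Slack5SearchSound`). Nothing here is progress on `ω`.
-/

namespace Summit.MatrixMultiplication.OmegaCensus.SmallFormats

set_option Elab.async false

set_option maxRecDepth 100000 in
set_option maxHeartbeats 400000000 in
/-- Elements `252 ≤ h < 256`. -/
theorem levelsOK5_ok_252_256 : ∀ h : Fin 336, 252 ≤ h.val → h.val < 256 → levelsOK5n h.val = true := by decide +kernel

set_option maxRecDepth 100000 in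
set_option maxHeartbeats 400000000 in
/-- Elements `256 ≤ h < 260`. -/
theorem levelsOK5_ok_256_260 : ∀ h : Fin 336, 256 ≤ h.val → h.val < 260 → levelsOK5n h.val = true := by decide +kernel

set_option maxRecDepth 100000 in
set_option maxHeartbeats 400000000 in
/-- Elements `260 ≤ h < 264`. -/
theorem levelsOK5_ok_260_264 : ∀ h : Fin 336, 260 ≤ h.val → h.val < 264 → levelsOK5n h.val = true := by decide +kernel

set_option maxRecDepth 100000 in
set_option maxHeartbeats 400000000 in
/-- Elements `264 ≤ h < 268`. -/
theorem levelsOK5_ok_264_268 : ∀ h : Fin 336, 264 ≤ h.val → h.val < 268 → levelsOK5n h.val = true := by decide +kernel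

set_option maxRecDepth 100000 in
set_option maxHeartbeats 400000000 in
/-- Elements `268 ≤ h < 272`. -/
theorem levelsOK5_ok_268_272 : ∀ h : Fin 336, 268 ≤ h.val → h.val < 272 → levelsOK5n h.val = true := by decide +kernel

set_option maxRecDepth 100000 in
set_option maxHeartbeats 400000000 in
/-- Elements `272 ≤ h < 276`. -/
theorem levelsOK5_ok_272_276 : ∀ h : Fin 336, 272 ≤ h.val → h.val < 276 → levelsOK5n h.val = true := by decide +kernel

set_option maxRecDepth 100000 in
set_option maxHeartbeats 400000000 in
/-- Elements `276 ≤ h < 280`. -/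
theorem levelsOK5_ok_276_280 : ∀ h : Fin 336, 276 ≤ h.val → h.val < 280 → levelsOK5n h.val = true := by decide +kernel

/-- CHECK A for the elements `252 ≤ h < 280`. -/
theorem levelsOK5_run_10 : ∀ h : Fin 336, 252 ≤ h.val → h.val < 280 → levelsOK5n h.val = true := by
  intro h hlo hhi
  by_cases h256 : h.val < 256
  · exact levelsOK5_ok_252_256 h (by omega) h256
  by_cases h260 : h.val < 260
  · exact levelsOK5_ok_256_260 h (by omega) h260
  by_cases h264 : h.val < 264
  · exact levelsOK5_ok_260_264 h (by omega) h264
  by_cases h268 : h.val < 268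
  · exact levelsOK5_ok_264_268 h (by omega) h268
  by_cases h272 : h.val < 272
  · exact levelsOK5_ok_268_272 h (by omega) h272
  by_cases h276 : h.val < 276
  · exact levelsOK5_ok_272_276 h (by omega) h276
  exact levelsOK5_ok_276_280 h (by omega) hhi

end Summit.MatrixMultiplication.OmegaCensus.SmallFormats
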